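/-
Copyright (c) 2026. All rights reserved.
Released under Apache 2.0 license as described in the file LICENSE.
-/
import Summits.HubbardSuperconductivity.HubbardLadder.Bounds.SectorTwistRatioWindow
import HarnessLib

/-!
# No stiffness above `T₁` in the fixed-`N` sectors of the `t–t'` Hubbard torus — KERNEL-PROVED
# (pub-hubbard BOUNDS, bounds.tex §13, Theorem 13_N (i)_N, (ii)_N, (iv)_N; D5 closed)

HONEST FRAMING: ladder R1–R4 with certified numbers; no claim on H/H₀. These are rigorous bounds
for a MODEL CLASS (the REPULSIVE `t–t'` Hubbard torus with a flux twist, in its canonical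
fixed-particle-number sectors `N`), no materials claim.

This is the fixed-`N` companion of `Bounds/HighTemperatureNoStiffnessCanonical.lean` (the
`(N↑, N↓)` sector nodes, which are PAPER-proved and carry no `_holds`). Here every node carries a
`_holds`: the chain #211.1–.25 (complex-fugacity Fourier projection of the sector, Ueltschi's
polymer expansion on the arc with the Kotecký–Preiss criterion, the off-arc volume factor, the
centred-fugacity floor from the `±1`-particle transfer walk, assembled in #211.23/.24 and
instantiated in the certified window in #211.25 `norm_ttSectorZ_twist_sub_le_window`) gives
`‖Z_N(θ) - Z_N(0)‖ ≤ G(L) · Re Z_N(0)` with the explicit majorant `G = twistWindowMajorant`, and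
`G(L) → 0` (`tendsto_twistWindowMajorant`: `G(L) ≤ (8/5)e^{1606} L³e^{-(283/500)L} +
16e^{1606 + 96/5} L e^{-L}`).

* `HighTemperatureTwistInsensitivityTT'CanonicalN` + `_holds` (Thm 13_N (i)_N, ratio form): in the
  window `0 < β`, `0 ≤ U`, `β(1 + |t'|) ≤ 10⁻⁴`, `βU ≤ 1/500`, for every `ε > 0` there is `L₀(ε)`
  such that for all `L ≥ L₀`, every `N` with `3L² ≤ 5N ≤ 7L²` and EVERY seam twist `θ`,
  `‖Z_N(θ) - Z_N(0)‖ ≤ ε Re Z_N(0)`, `Z_N(θ) = ttSectorZ L β t' U θ N` (the `N`-particle block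
  partition function of `hubbardTorusTT'Flux L t' U θ`; a chemical potential is constant on the
  sector and drops out).
* `HighTemperatureTwistInsensitivityTT'CanonicalNLog` + `_holds` ((i)_N in free-energy form):
  `|log Re Z_N(0) - log Re Z_N(θ)| ≤ ε` (from the ratio form with `ε' = min(ε/2, 1/2)`).
* `HighTemperatureNoThermalStiffnessTT'CanonicalN` + `_holds` ((ii)_N): every flux stiffness
  `ρ_s` of the sector free energy (`βρ_sθ² ≤ log Re Z_N(0) - log Re Z_N(θ)` on `|θ| ≤ θ₀`) obeys
  `ρ_s ≤ ε/(βθ₀²)` for `L ≥ L₀(ε)`.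
* `HighTemperatureSectorStiffnessVanishesTT'CanonicalN` + `_holds` ((iv)_N): at fixed `β, θ₀`,
  every sector flux stiffness is `≤ η` beyond some `L₀(β, θ₀, η)`.

HONEST SIZE (stated, not hidden): the `L₀` delivered by the proof is astronomically conservative
(`G(L) < 1` first at `L = 2881`; walk factor `e^{0.384L + 1606}`); the window
(`T ≥ 10⁴(|t| + |t'|)`, `T ≥ 500U`, `N/L² ∈ [3/5, 7/5]`) is smaller than the paper's `I_c4`
(`β(|t|+|t'|) ≤ 1/1250`, `β|U| ≤ 1/50`, where the `(N↑,N↓)` statement is paper-proved with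
`E_L ≤ 10^{-7.09}` at `L = 100`); REPULSIVE class only; no finite-`L` instance row. Zero kit, no
`native_decide`, standard axioms only.
References: R. Kotecký, D. Preiss, Comm. Math. Phys. 103 (1986) 491 [KoteckyPreiss1986];
D. Ueltschi, Analyticity in Hubbard models, J. Stat. Phys. 95 (1999) 693, §2.3 Prop. 2.2
[Ueltschi1999]; bounds.tex §13.
-/

noncomputable section

namespace Summit.HubbardSuperconductivity.HubbardLadder.Bounds

open Matrix Finset Complex Filter Topology
open Literature.MathematicalPhysics.QuantumLattice
open scoped ComplexOrder

/-! ### The majorant tends to zero -/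

/-- Pointwise: `G(x) ≤ (8/5)e^{1606}·x³e^{-(283/500)x} + 16e^{1606+96/5}·xe^{-x}` for `x ≥ 0`
(`e^{(48/125)x}e^{-(19/20)x} = e^{-(283/500)x}`; `(48/125)x - x²/40 ≤ 96/5 - x` by completing the
square). [this file] -/
theorem twistWindowMajorant_real_le {x : ℝ} (hx : 0 ≤ x) :
    8 * x * Real.exp (48 / 125 * x + 1606) *
        (1 / 5 * x ^ 2 * Real.exp (-(19 / 20 * x)) + 2 * Real.exp (-(1 / 40 * x ^ 2))) ≤
      8 / 5 * Real.exp 1606 * (x ^ 3 * Real.exp (-(283 / 500 * x))) +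
        16 * Real.exp (1606 + 96 / 5) * (x * Real.exp (-x)) := by
  have h1 : Real.exp (48 / 125 * x + 1606) * Real.exp (-(19 / 20 * x)) =
      Real.exp 1606 * Real.exp (-(283 / 500 * x)) := by
    rw [← Real.exp_add, ← Real.exp_add]; congr 1; ring
  have h2 : Real.exp (48 / 125 * x + 1606) * Real.exp (-(1 / 40 * x ^ 2)) ≤
      Real.exp (1606 + 96 / 5) * Real.exp (-x) := by
    rw [← Real.exp_add, ← Real.exp_add]
    exact Real.exp_le_exp.2 (by nlinarith [sq_nonneg (x - 692 / 25)])
  have h3 := mul_le_mul_of_nonneg_left h2 (by positivity : (0 : ℝ) ≤ 16 * x)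
  calc 8 * x * Real.exp (48 / 125 * x + 1606) *
        (1 / 5 * x ^ 2 * Real.exp (-(19 / 20 * x)) + 2 * Real.exp (-(1 / 40 * x ^ 2)))
      = 8 / 5 * x ^ 3 * (Real.exp (48 / 125 * x + 1606) * Real.exp (-(19 / 20 * x))) +
          16 * x * (Real.exp (48 / 125 * x + 1606) * Real.exp (-(1 / 40 * x ^ 2))) := by ring
    _ ≤ 8 / 5 * x ^ 3 * (Real.exp 1606 * Real.exp (-(283 / 500 * x))) +
          16 * x * (Real.exp (1606 + 96 / 5) * Real.exp (-x)) := by rw [h1]; linarith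
    _ = _ := by ring

/-- **`G(L) → 0`** (`x³e^{-γx} → 0`, `xe^{-x} → 0`). [this file] -/
theorem tendsto_twistWindowMajorant : Tendsto twistWindowMajorant atTop (𝓝 0) := by
  have t1 : Tendsto (fun x : ℝ => x ^ 3 * Real.exp (-(283 / 500 * x))) atTop (𝓝 0) := by
    refine (tendsto_rpow_mul_exp_neg_mul_atTop_nhds_zero 3 (283 / 500) (by norm_num)).congr ?_
    intro x
    rw [show (3 : ℝ) = ((3 : ℕ) : ℝ) by norm_num, Real.rpow_natCast, neg_mul]
  have t2 : Tendsto (fun x : ℝ => x * Real.exp (-x)) atTop (𝓝 0) := by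
    refine (Real.tendsto_pow_mul_exp_neg_atTop_nhds_zero 1).congr ?_
    intro x
    rw [pow_one]
  have t3 := (t1.const_mul (8 / 5 * Real.exp 1606)).add
    (t2.const_mul (16 * Real.exp (1606 + 96 / 5)))
  rw [mul_zero, mul_zero, add_zero] at t3
  have t4 := t3.comp tendsto_natCast_atTop_atTop
  refine tendsto_of_tendsto_of_tendsto_of_le_of_le tendsto_const_nhds t4
    (fun L => twistWindowMajorant_nonneg L) ?_
  intro L
  exact twistWindowMajorant_real_le (Nat.cast_nonneg L)

/-! ### Theorem 13_N (i)_N: twist insensitivity of the fixed-`N` sector partition functions -/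

/-- **Twist insensitivity of the fixed-`N` sector partition functions at high temperature,
ratio form** (bounds.tex Thm 13_N (i)_N; KERNEL-PROVED below). In the window `0 < β`, `0 ≤ U`,
`β(1 + |t'|) ≤ 1/10000`, `βU ≤ 1/500`: for every `ε > 0` there is `L₀` (depending on `ε` only)
such that for all `L ≥ L₀` (`L ≥ 3`), all `t' U β` in the window, every particle number `N` with
`3L² ≤ 5N ≤ 7L²` and every seam twist `θ`, `‖Z_N(θ) - Z_N(0)‖ ≤ ε · Re Z_N(0)` for the `N`-particle
block partition functions `Z_N(θ) = ttSectorZ L β t' U θ N` of `hubbardTorusTT'Flux L t' U θ`.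
[programme: bounds.tex §13 Theorem 13_N (i)_N; this file] -/
@[conjecture] def HighTemperatureTwistInsensitivityTT'CanonicalN : Prop :=
  ∀ ε : ℝ, 0 < ε → ∃ L₀ : ℕ, ∀ (L : ℕ) [NeZero L], 3 ≤ L → L₀ ≤ L →
    ∀ (t' U β : ℝ), 0 < β → 0 ≤ U → β * (1 + |t'|) ≤ 1 / 10000 → β * U ≤ 1 / 500 →
    ∀ N : ℕ, 3 * L ^ 2 ≤ 5 * N → 5 * N ≤ 7 * L ^ 2 → ∀ θ : ℝ,
      ‖ttSectorZ L β t' U θ N - ttSectorZ L β t' U 0 N‖ ≤ ε * (ttSectorZ L β t' U 0 N).re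

/-- **PROOF of Theorem 13_N (i)_N (ratio form)**: `G(L) → 0` and #211.25. [this file] -/
theorem highTemperatureTwistInsensitivityTT'CanonicalN_holds :
    HighTemperatureTwistInsensitivityTT'CanonicalN := by
  intro ε hε
  obtain ⟨L₁, hL₁⟩ :=
    Filter.eventually_atTop.1 ((tendsto_order.1 tendsto_twistWindowMajorant).2 ε hε)
  refine ⟨max L₁ 101, ?_⟩
  intro L _ _ hL t' U β hβ hU hS hu N hN₁ hN₂ θ
  have hG : twistWindowMajorant L < ε := hL₁ L (le_trans (le_max_left _ _) hL)
  have h := norm_ttSectorZ_twist_sub_le_window (le_trans (le_max_right _ _) hL) hβ hU t' θ hS hu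
    hN₁ hN₂
  have hΛ : Fintype.card (FermionTorus 2 L) = L ^ 2 := by simp [FermionTorus, Fintype.card_lex]
  have hO : Fintype.card (Orb (FermionTorus 2 L)) = 2 * L ^ 2 := by
    rw [Fintype.card_lex, Fintype.card_prod, Fintype.card_fin, hΛ, mul_comm]
  have hre : 0 ≤ (ttSectorZ L β t' U 0 N).re := (ttSectorZ_pos β t' U 0 (by omega)).1.le
  exact h.trans (mul_le_mul_of_nonneg_right hG.le hre)

/-- Logarithms: `|b - a| ≤ e·a` with `a > 0`, `e ≤ 1/2` gives `|log a - log b| ≤ 2e`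
(`log y ≤ y - 1`). [this file] -/
theorem ttWindow_abs_log_sub_log_le {a b e : ℝ} (ha : 0 < a) (he : e ≤ 1 / 2)
    (h : |b - a| ≤ e * a) : |Real.log a - Real.log b| ≤ 2 * e := by
  have hup := (abs_sub_le_iff.1 h).1
  have hdn := (abs_sub_le_iff.1 h).2
  have he0 : 0 ≤ e := by nlinarith [abs_nonneg (b - a)]
  have hb : 0 < b := by nlinarith
  rw [abs_le]
  constructor
  · have h1 : Real.log (b / a) = Real.log b - Real.log a := Real.log_div hb.ne' ha.ne'
    have h2 : Real.log (b / a) ≤ b / a - 1 := Real.log_le_sub_one_of_pos (div_pos hb ha)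
    have h3 : b / a - 1 ≤ e := by rw [div_sub_one ha.ne', div_le_iff₀ ha]; linarith
    linarith
  · have h1 : Real.log (a / b) = Real.log a - Real.log b := Real.log_div ha.ne' hb.ne'
    have h2 : Real.log (a / b) ≤ a / b - 1 := Real.log_le_sub_one_of_pos (div_pos ha hb)
    have h4 : e * a ≤ (2 * e - 2 * e ^ 2) * a := by
      nlinarith [mul_nonneg he0 (sub_nonneg.2 he)]
    have h3 : a / b - 1 ≤ 2 * e := by
      rw [div_sub_one hb.ne', div_le_iff₀ hb]
      nlinarith [mul_nonneg he0 (by linarith : 0 ≤ b - (1 - e) * a)]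
    linarith

/-- **Twist insensitivity of the fixed-`N` sector free energies at high temperature**
(bounds.tex Thm 13_N (i)_N, free-energy form; KERNEL-PROVED below): same window and quantifiers,
`|log Re Z_N(0) - log Re Z_N(θ)| ≤ ε`. [programme: bounds.tex §13 Theorem 13_N (i)_N; this file] -/
@[conjecture] def HighTemperatureTwistInsensitivityTT'CanonicalNLog : Prop :=
  ∀ ε : ℝ, 0 < ε → ∃ L₀ : ℕ, ∀ (L : ℕ) [NeZero L], 3 ≤ L → L₀ ≤ L →
    ∀ (t' U β : ℝ), 0 < β → 0 ≤ U → β * (1 + |t'|) ≤ 1 / 10000 → β * U ≤ 1 / 500 →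
    ∀ N : ℕ, 3 * L ^ 2 ≤ 5 * N → 5 * N ≤ 7 * L ^ 2 → ∀ θ : ℝ,
      |Real.log (ttSectorZ L β t' U 0 N).re - Real.log (ttSectorZ L β t' U θ N).re| ≤ ε

/-- **PROOF of Theorem 13_N (i)_N (free-energy form)** from the ratio form with
`ε' = min(ε/2, 1/2)`. [this file] -/
theorem highTemperatureTwistInsensitivityTT'CanonicalNLog_holds :
    HighTemperatureTwistInsensitivityTT'CanonicalNLog := by
  intro ε hε
  have hε' : 0 < min (ε / 2) (1 / 2) := lt_min (by linarith) (by norm_num)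
  obtain ⟨L₀, hL₀⟩ := highTemperatureTwistInsensitivityTT'CanonicalN_holds _ hε'
  refine ⟨L₀, ?_⟩
  intro L _ h3 hL t' U β hβ hU hS hu N hN₁ hN₂ θ
  have h := hL₀ L h3 hL t' U β hβ hU hS hu N hN₁ hN₂ θ
  have hΛ : Fintype.card (FermionTorus 2 L) = L ^ 2 := by simp [FermionTorus, Fintype.card_lex]
  have hO : Fintype.card (Orb (FermionTorus 2 L)) = 2 * L ^ 2 := by
    rw [Fintype.card_lex, Fintype.card_prod, Fintype.card_fin, hΛ, mul_comm]
  have hpos := (ttSectorZ_pos β t' U 0 (k := N) (L := L) (by omega)).1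
  have hre : |(ttSectorZ L β t' U θ N).re - (ttSectorZ L β t' U 0 N).re| ≤
      min (ε / 2) (1 / 2) * (ttSectorZ L β t' U 0 N).re := by
    rw [← Complex.sub_re]; exact (Complex.abs_re_le_norm _).trans h
  have := ttWindow_abs_log_sub_log_le hpos (min_le_right _ _) hre
  linarith [min_le_left (ε / 2) (1 / 2)]

/-! ### Theorem 13_N (ii)_N and (iv)_N: no stiffness in the fixed-`N` sectors -/

/-- **No thermal stiffness above `T₁` in the fixed-`N` sectors** (bounds.tex Thm 13_N (ii)_N;
KERNEL-PROVED below). In the same window, for every `ε > 0` there is `L₀(ε)` such that for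
`L ≥ L₀` every flux stiffness `ρ_s` of a fixed-`N` sector free energy in the density window —
`βρ_sθ² ≤ log Re Z_N(0) - log Re Z_N(θ)` for `|θ| ≤ θ₀`, `θ₀ > 0` — satisfies `ρ_s ≤ ε/(βθ₀²)`.
[programme: bounds.tex §13 Theorem 13_N (ii)_N; this file] -/
@[conjecture] def HighTemperatureNoThermalStiffnessTT'CanonicalN : Prop :=
  ∀ ε : ℝ, 0 < ε → ∃ L₀ : ℕ, ∀ (L : ℕ) [NeZero L], 3 ≤ L → L₀ ≤ L →
    ∀ (t' U β ρs θ₀ : ℝ), 0 < β → 0 ≤ U → β * (1 + |t'|) ≤ 1 / 10000 → β * U ≤ 1 / 500 →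
    0 < θ₀ → ∀ N : ℕ, 3 * L ^ 2 ≤ 5 * N → 5 * N ≤ 7 * L ^ 2 →
    (∀ θ : ℝ, |θ| ≤ θ₀ → β * ρs * θ ^ 2 ≤
        Real.log (ttSectorZ L β t' U 0 N).re - Real.log (ttSectorZ L β t' U θ N).re) →
    ρs ≤ ε / (β * θ₀ ^ 2)

/-- **Reduction** ((i)_N ⇒ (ii)_N): evaluate the stiffness hypothesis at `θ = θ₀` and divide by
`βθ₀² > 0`. [this file] -/
theorem highTemperatureNoThermalStiffnessTT'CanonicalN_of_insensitivity
    (h : HighTemperatureTwistInsensitivityTT'CanonicalNLog) :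
    HighTemperatureNoThermalStiffnessTT'CanonicalN := by
  intro ε hε
  obtain ⟨L₀, hL₀⟩ := h ε hε
  refine ⟨L₀, ?_⟩
  intro L _ hL hLL t' U β ρs θ₀ hβ hU hy hu hθ₀ N h1 h2 hstiff
  have hins := hL₀ L hL hLL t' U β hβ hU hy hu N h1 h2 θ₀
  have hE := hstiff θ₀ (by rw [abs_of_pos hθ₀])
  have hpos : 0 < β * θ₀ ^ 2 := mul_pos hβ (pow_pos hθ₀ 2)
  rw [le_div_iff₀ hpos]
  calc ρs * (β * θ₀ ^ 2) = β * ρs * θ₀ ^ 2 := by ring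
    _ ≤ _ := hE
    _ ≤ _ := le_abs_self _
    _ ≤ ε := hins

/-- **PROOF of Theorem 13_N (ii)_N.** [this file] -/
theorem highTemperatureNoThermalStiffnessTT'CanonicalN_holds :
    HighTemperatureNoThermalStiffnessTT'CanonicalN :=
  highTemperatureNoThermalStiffnessTT'CanonicalN_of_insensitivity
    highTemperatureTwistInsensitivityTT'CanonicalNLog_holds

/-- **The `T_c` reading: fixed-`N` sector stiffnesses vanish as `L → ∞`** (bounds.tex Thm 13_N
(iv)_N; KERNEL-PROVED below): for every fixed `β > 0`, `θ₀ > 0`, `η > 0` there is `L₀` beyond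
which, for all `t'`, `U ≥ 0` with `β(1 + |t'|) ≤ 10⁻⁴`, `βU ≤ 1/500` and every `N` in the density
window, every flux stiffness on `|θ| ≤ θ₀` is `≤ η`.
[programme: bounds.tex §13 Theorem 13_N (iv)_N; this file] -/
@[conjecture] def HighTemperatureSectorStiffnessVanishesTT'CanonicalN : Prop :=
  ∀ (β θ₀ η : ℝ), 0 < β → 0 < θ₀ → 0 < η →
    ∃ L₀ : ℕ, ∀ (L : ℕ) [NeZero L], 3 ≤ L → L₀ ≤ L →
      ∀ (t' U ρs : ℝ), 0 ≤ U → β * (1 + |t'|) ≤ 1 / 10000 → β * U ≤ 1 / 500 →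
      ∀ N : ℕ, 3 * L ^ 2 ≤ 5 * N → 5 * N ≤ 7 * L ^ 2 →
      (∀ θ : ℝ, |θ| ≤ θ₀ → β * ρs * θ ^ 2 ≤
          Real.log (ttSectorZ L β t' U 0 N).re - Real.log (ttSectorZ L β t' U θ N).re) →
      ρs ≤ η

/-- **Reduction** ((ii)_N ⇒ (iv)_N) with `ε = ηβθ₀²`. [this file] -/
theorem highTemperatureSectorStiffnessVanishesTT'CanonicalN_of_noStiffness
    (h : HighTemperatureNoThermalStiffnessTT'CanonicalN) :
    HighTemperatureSectorStiffnessVanishesTT'CanonicalN := by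
  intro β θ₀ η hβ hθ₀ hη
  have hε : 0 < η * (β * θ₀ ^ 2) := mul_pos hη (mul_pos hβ (pow_pos hθ₀ 2))
  obtain ⟨L₀, hL₀⟩ := h (η * (β * θ₀ ^ 2)) hε
  refine ⟨L₀, ?_⟩
  intro L _ hL hLL t' U ρs hU hy hu N h1 h2 hstiff
  have := hL₀ L hL hLL t' U β ρs θ₀ hβ hU hy hu hθ₀ N h1 h2 hstiff
  rwa [mul_div_assoc, div_self (ne_of_gt (mul_pos hβ (pow_pos hθ₀ 2))), mul_one] at this

/-- **PROOF of Theorem 13_N (iv)_N.** [this file] -/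
theorem highTemperatureSectorStiffnessVanishesTT'CanonicalN_holds :
    HighTemperatureSectorStiffnessVanishesTT'CanonicalN :=
  highTemperatureSectorStiffnessVanishesTT'CanonicalN_of_noStiffness
    highTemperatureNoThermalStiffnessTT'CanonicalN_holds

end Summit.HubbardSuperconductivity.HubbardLadder.Bounds

end
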